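import Summits.AtomisticToContinuum.FouriersLaw.Theses.HonestZwanzig
import Summits.AtomisticToContinuum.FouriersLaw.Theorems.OddSectorIrreversibilityOddDensityIsCorrectorDissipativity

/-!
# HonestZwanzig / OrthogonalOhm — stub F2 `DirichletBound`, helper file: the cutoff identity

Support file for crux item `stmt-AtomisticToContinuum-12693` (`HonestZwanzig.OrthogonalOhm`, sub-problem
`FouriersLaw`), line `Sketch`, registered stub `stub_dirichletBound` (proved in
`HonestZwanzigOrthogonalOhmDirichletBound.lean`); this file carries the registered helper stub
`helper_dirichletBoundCutoffIdentity`.  For a chain with `C¹` potentials, `ρ = e^{-H/T}`, `w ∈ C²`, `χ ∈ C²_c`: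

* `integral_bath_mul_mul_cutoff_sq` — carré du champ of an Ornstein–Uhlenbeck tap with a cutoff:
  `∫ (T∂²_{p_i}w − p_i∂_{p_i}w)(wχ²) ρ = −T(∫ (∂_{p_i}w)² χ² ρ + 2∫ w χ ∂_{p_i}χ ∂_{p_i}w ρ)`;
* `integral_liouville_mul_mul_cutoff_sq` — the Liouville part drops out when `{H, χ²} = 0` termwise;
* `integrable_of_integral_cutoff_le` — Fatou: `0 ≤ κ_R → 1`, `∫ κ_R F ≤ C` for large `R` ⇒ `F ∈ L¹`;
* `cutoff_identity` — pinned anharmonic chain (`ω₂ > 0`, `lam, β ≥ 0`, `N ≥ 2`, `T > 0`), `L_{T,T} w = -g`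
  pointwise, energy cutoffs `χ_R = χ(H/R)`:
  `∫ g w χ_R² ρ = γT Σ_{b ∈ {0, N-1}} (∫ (∂_{p_b}w)² χ_R² ρ + 2 ∫ w χ_R ∂_{p_b}χ_R ∂_{p_b}w ρ)`;
* `integrable_weights` — `g w ρ, p_i² w² ρ ∈ L¹` for continuous `w, g = O(e^{H/(8T)})`.
-/

noncomputable section

open MeasureTheory Filter Topology Set Function
open scoped ContDiff
open Literature.MathematicalPhysics.KineticTheory.HeatConduction

namespace Summit.AtomisticToContinuum.FouriersLaw.Theorems.HonestZwanzig

namespace OrthogonalOhmLine.DirichletBound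

open Summit.AtomisticToContinuum.FouriersLaw.Theorems.OddSectorIrreversibility
  (integral_bath_mul_gibbsDensity_eq_neg sum_ite_ends_eq integral_liouville_mul_mul_gibbsDensity
    integral_bath_mul_mul_gibbsDensity liouville_comp_hamiltonian_eq_zero hasDerivAt_smoothCutoff_div
    contDiff_energyCutoff hasCompactSupport_energyCutoff partialP_energyCutoff)

variable {N : ℕ}

/-! ### Two integrations by parts with a cutoff -/

/-- **Carré du champ with a cutoff.** For `C¹` potentials, `T ≠ 0`, `w ∈ C²` and a cutoff `χ ∈ C²_c`:
`∫ (T∂²_{p_i}w − p_i∂_{p_i}w)(wχ²) e^{-H/T} = −T(∫ (∂_{p_i}w)² χ² e^{-H/T} + 2∫ w χ ∂_{p_i}χ ∂_{p_i}w e^{-H/T})`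
(symmetry of the Ornstein–Uhlenbeck tap, one integration by parts, `∂_{p_i}(wχ²) = 2wχ∂_{p_i}χ + χ²∂_{p_i}w`). -/
theorem integral_bath_mul_mul_cutoff_sq (P : OscillatorChain) (hU : ContDiff ℝ 1 P.U) (hV : ContDiff ℝ 1 P.V)
    (N : ℕ) {T : ℝ} (hT : T ≠ 0) {w χ : PhaseSpace N → ℝ} (hw : ContDiff ℝ 2 w) (hχ : ContDiff ℝ 2 χ)
    (hχc : HasCompactSupport χ) (i : Fin N) :
    ∫ x, (T * partialP i (partialP i w) x - x.2 i * partialP i w x) * (w x * (χ x * χ x)) *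
        P.gibbsDensity N T x =
      -T * ((∫ x, (partialP i w x) ^ 2 * (χ x * χ x) * P.gibbsDensity N T x) +
        2 * ∫ x, w x * χ x * partialP i χ x * partialP i w x * P.gibbsDensity N T x) := by
  set ρ := P.gibbsDensity N T with hρ
  have hwd : Differentiable ℝ w := hw.differentiable two_ne_zero
  have hχd : Differentiable ℝ χ := hχ.differentiable two_ne_zero
  have hχχd : Differentiable ℝ (fun y => χ y * χ y) := hχd.mul hχd
  have hρc : Continuous ρ := P.continuous_gibbsDensity hU.continuous hV.continuous N T
  set F : PhaseSpace N → ℝ := fun x => w x * (χ x * χ x) with hF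
  have hFs : ContDiff ℝ 2 F := hw.mul (hχ.mul hχ)
  have hFc : HasCompactSupport F := (hχc.mul_left (f := χ)).mul_left
  -- symmetry of the tap, then the carré du champ
  have hsym := integral_bath_mul_mul_gibbsDensity P hU hV N T hT hFs hFc hw i
  have hcar := integral_bath_mul_gibbsDensity_eq_neg P hU hV N hT hFs hFc (hw.of_le (by norm_num)) i
  have e0 : ∫ x, (T * partialP i (partialP i w) x - x.2 i * partialP i w x) * (w x * (χ x * χ x)) * ρ x =
      ∫ x, F x * (T * partialP i (partialP i w) x - x.2 i * partialP i w x) * ρ x :=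
    integral_congr_ae (Eventually.of_forall fun x => by simp only [hF]; ring)
  rw [e0, ← hsym, hcar]
  -- `∂_{p_i} F = w (2χ ∂χ) + χ² ∂w`
  have hdF : ∀ x, partialP i F x = w x * (2 * χ x * partialP i χ x) + χ x * χ x * partialP i w x := by
    intro x
    have hp := OddSectorIrreversibility.partialP_mul hwd hχχd i x
    have hp2 := OddSectorIrreversibility.partialP_mul hχd hχd i x
    simp only [hF] at hp ⊢
    rw [hp, hp2]
    ring
  have hPwc : Continuous (partialP i w) := continuous_partialP hw two_ne_zero i
  have hPχc : Continuous (partialP i χ) := continuous_partialP hχ two_ne_zero i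
  have hPχcs : HasCompactSupport (partialP i χ) := hasCompactSupport_partialP hχd hχc i
  have iD : Integrable fun x => (partialP i w x) ^ 2 * (χ x * χ x) * ρ x :=
    (((hPwc.pow 2).mul (hχ.continuous.mul hχ.continuous)).mul hρc).integrable_of_hasCompactSupport
      ((hχc.mul_left (f := χ)).mul_left.mul_right)
  have iE : Integrable fun x => w x * χ x * partialP i χ x * partialP i w x * ρ x :=
    ((((hw.continuous.mul hχ.continuous).mul hPχc).mul hPwc).mul hρc).integrable_of_hasCompactSupport
      (hPχcs.mul_left.mul_right.mul_right)
  have e1 : ∫ x, partialP i F x * partialP i w x * ρ x =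
      (∫ x, (partialP i w x) ^ 2 * (χ x * χ x) * ρ x) +
        2 * ∫ x, w x * χ x * partialP i χ x * partialP i w x * ρ x := by
    rw [← integral_const_mul, ← integral_add iD (iE.const_mul 2)]
    exact integral_congr_ae (Eventually.of_forall fun x => by dsimp only; rw [hdF x]; ring)
  rw [e1]

/-- **The Liouville part drops out.** For `C¹` potentials, `w ∈ C¹` and a cutoff `χ ∈ C¹_c` with
`{H, χ²} = 0` termwise: `∫ (p_i∂_{q_i}w − ∂_{q_i}H ∂_{p_i}w)(wχ²) e^{-H/T} = 0` (antisymmetry of the Hamiltonian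
vector field in `L²(e^{-H/T})` and the product rule). -/
theorem integral_liouville_mul_mul_cutoff_sq (P : OscillatorChain) (hU : ContDiff ℝ 1 P.U)
    (hV : ContDiff ℝ 1 P.V) (N : ℕ) (T : ℝ) {w χ : PhaseSpace N → ℝ} (hw : ContDiff ℝ 1 w)
    (hχ : ContDiff ℝ 1 χ) (hχc : HasCompactSupport χ)
    (hLχ : ∀ x, ∀ i : Fin N, x.2 i * partialQ i (fun y => χ y * χ y) x -
      partialQ i (P.hamiltonian N) x * partialP i (fun y => χ y * χ y) x = 0) (i : Fin N) :
    ∫ x, (x.2 i * partialQ i w x - partialQ i (P.hamiltonian N) x * partialP i w x) *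
      (w x * (χ x * χ x)) * P.gibbsDensity N T x = 0 := by
  set ρ := P.gibbsDensity N T with hρ
  have hwd : Differentiable ℝ w := hw.differentiable one_ne_zero
  have hχd : Differentiable ℝ χ := hχ.differentiable one_ne_zero
  have hχχd : Differentiable ℝ (fun y => χ y * χ y) := hχd.mul hχd
  set F : PhaseSpace N → ℝ := fun x => w x * (χ x * χ x) with hF
  have hF1 : ContDiff ℝ 1 F := hw.mul (hχ.mul hχ)
  have hFc : HasCompactSupport F := (hχc.mul_left (f := χ)).mul_left
  have hanti := integral_liouville_mul_mul_gibbsDensity P hU hV N T hF1 hFc hw i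
  have hprod : ∀ x, x.2 i * partialQ i F x - partialQ i (P.hamiltonian N) x * partialP i F x =
      (χ x * χ x) * (x.2 i * partialQ i w x - partialQ i (P.hamiltonian N) x * partialP i w x) := by
    intro x
    have hq := OddSectorIrreversibility.partialQ_mul hwd hχχd i x
    have hp := OddSectorIrreversibility.partialP_mul hwd hχχd i x
    simp only [hF] at hq hp ⊢
    rw [hq, hp]
    have := hLχ x i
    linear_combination w x * this
  simp_rw [hprod] at hanti
  have e : ∫ x, (χ x * χ x) * (x.2 i * partialQ i w x - partialQ i (P.hamiltonian N) x * partialP i w x) *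
      w x * ρ x = -∫ x, (x.2 i * partialQ i w x - partialQ i (P.hamiltonian N) x * partialP i w x) *
        (w x * (χ x * χ x)) * ρ x := by
    rw [hanti, ← integral_neg]
    exact integral_congr_ae (Eventually.of_forall fun x => by simp only [hF]; ring)
  have e' : ∫ x, (χ x * χ x) * (x.2 i * partialQ i w x - partialQ i (P.hamiltonian N) x * partialP i w x) *
      w x * ρ x = ∫ x, (x.2 i * partialQ i w x - partialQ i (P.hamiltonian N) x * partialP i w x) *
        (w x * (χ x * χ x)) * ρ x :=
    integral_congr_ae (Eventually.of_forall fun x => by ring)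
  linarith

/-! ### Fatou for cutoffs -/

/-- **Fatou with cutoffs**: if `0 ≤ F`, `0 ≤ κ_R → 1` pointwise and `∫ κ_R F ≤ C` for all large `R`, then
`F ∈ L¹`. -/
theorem integrable_of_integral_cutoff_le {α : Type*} [MeasurableSpace α] {μ : Measure α}
    {F : α → ℝ} {κ : ℝ → α → ℝ} (hFm : AEStronglyMeasurable F μ) (hF0 : ∀ x, 0 ≤ F x)
    (hκm : ∀ R, AEStronglyMeasurable (κ R) μ) (hκ0 : ∀ R x, 0 ≤ κ R x)
    (hκ1 : ∀ x, Tendsto (fun R => κ R x) atTop (𝓝 1))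
    (hint : ∀ᶠ R in atTop, Integrable (fun x => κ R x * F x) μ) {C : ℝ}
    (hC : ∀ᶠ R in atTop, ∫ x, κ R x * F x ∂μ ≤ C) : Integrable F μ := by
  refine ⟨hFm, ?_⟩
  rw [hasFiniteIntegral_iff_ofReal (ae_of_all _ hF0)]
  have hlim : ∀ x, Tendsto (fun R => ENNReal.ofReal (κ R x * F x)) atTop (𝓝 (ENNReal.ofReal (F x))) := by
    intro x
    refine ENNReal.tendsto_ofReal ?_
    simpa using (hκ1 x).mul_const (F x)
  calc ∫⁻ x, ENNReal.ofReal (F x) ∂μ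
      = ∫⁻ x, liminf (fun R => ENNReal.ofReal (κ R x * F x)) atTop ∂μ :=
        lintegral_congr fun x => ((hlim x).liminf_eq).symm
    _ ≤ liminf (fun R => ∫⁻ x, ENNReal.ofReal (κ R x * F x) ∂μ) atTop :=
        lintegral_liminf_le' fun R => ((hκm R).mul hFm).aemeasurable.ennreal_ofReal
    _ ≤ ENNReal.ofReal C := by
        refine liminf_le_of_frequently_le' (Eventually.frequently ?_)
        filter_upwards [hint, hC] with R hR hRC
        rw [← ofReal_integral_eq_lintegral_ofReal hR (ae_of_all _ fun x => mul_nonneg (hκ0 R x) (hF0 x))]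
        exact ENNReal.ofReal_le_ofReal hRC
    _ < ⊤ := ENNReal.ofReal_lt_top

/-! ### Elementary inequalities -/

/-- `|∂_{p_i} χ_R| ≤ (M/R) |p_i|` for the energy cutoff `χ_R = χ(H/R)` (`M = sup|χ'|`, `R > 0`). -/
theorem abs_partialP_energyCutoff_le (P : OscillatorChain) (N : ℕ) {R : ℝ} (hR : 0 < R) {M : ℝ}
    (hM : ∀ u, |deriv smoothCutoff u| ≤ M) (i : Fin N) (x : PhaseSpace N) :
    |partialP i (fun y : PhaseSpace N => smoothCutoff (P.hamiltonian N y / R)) x| ≤ M / R * |x.2 i| := by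
  rw [partialP_energyCutoff, abs_mul, abs_div, abs_of_pos hR]
  exact mul_le_mul_of_nonneg_right (div_le_div_of_nonneg_right (hM _) hR.le) (abs_nonneg _)

/-- The cross term of the carré du champ, pointwise (Young): for `0 ≤ χ`, `|∂χ| ≤ K|p|`,
`|2 w χ ∂χ ∂w| ≤ (∂w)² χ²/2 + 2K² p² w²`. -/
theorem abs_cross_le_young {w χ dχ dw p K : ℝ} (hdχ : |dχ| ≤ K * |p|) :
    |2 * (w * χ * dχ * dw)| ≤ dw ^ 2 * (χ * χ) / 2 + 2 * K ^ 2 * (p ^ 2 * w ^ 2) := by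
  have h1 : |2 * (w * χ * dχ * dw)| = |2 * ((dw * χ) * (w * dχ))| := by ring_nf
  rw [h1]
  have h0 : |2 * ((dw * χ) * (w * dχ))| ≤ (dw * χ) ^ 2 / 2 + 2 * (w * dχ) ^ 2 := by
    rw [abs_le]
    constructor <;> nlinarith [sq_nonneg (dw * χ - 2 * (w * dχ)), sq_nonneg (dw * χ + 2 * (w * dχ))]
  refine h0.trans ?_
  have h2 : (w * dχ) ^ 2 ≤ K ^ 2 * (p ^ 2 * w ^ 2) := by
    have h3 : |dχ| ^ 2 ≤ (K * |p|) ^ 2 := pow_le_pow_left₀ (abs_nonneg _) hdχ 2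
    rw [sq_abs, mul_pow, sq_abs] at h3
    nlinarith [sq_nonneg w]
  nlinarith [h2]

/-- The cross term of the carré du champ, pointwise (AM–GM): for `|χ| ≤ 1`, `|∂χ| ≤ K|p|`,
`|w χ ∂χ ∂w| ≤ K (p²w² + (∂w)²)/2`. -/
theorem abs_cross_le_amgm {w χ dχ dw p K : ℝ} (hK : 0 ≤ K) (hχ1 : |χ| ≤ 1) (hdχ : |dχ| ≤ K * |p|) :
    |w * χ * dχ * dw| ≤ K * (((p * w) ^ 2 + dw ^ 2) / 2) := by
  calc |w * χ * dχ * dw| = |χ| * (|dχ| * |w * dw|) := by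
        rw [abs_mul, abs_mul, abs_mul, abs_mul]; ring
    _ ≤ 1 * ((K * |p|) * |w * dw|) :=
        mul_le_mul hχ1 (mul_le_mul_of_nonneg_right hdχ (abs_nonneg _)) (by positivity) zero_le_one
    _ = K * |(p * w) * dw| := by rw [abs_mul (p * w), abs_mul p w, abs_mul w dw]; ring
    _ ≤ K * (((p * w) ^ 2 + dw ^ 2) / 2) := by
        refine mul_le_mul_of_nonneg_left ?_ hK
        rw [abs_le]
        constructor <;> nlinarith [sq_nonneg (p * w - dw), sq_nonneg (p * w + dw)]

/-! ### The cutoff identity for the pinned chain -/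

section Pinned

variable {ω₂ lam β γ : ℝ} (hω : 0 < ω₂) (hl : 0 ≤ lam) (hβ : 0 ≤ β) (hN : 2 ≤ N) {T : ℝ} (hT : 0 < T)
include hω hl hβ hN hT

/-- **The cutoff identity.** For `w ∈ C²` with `L_{T,T} w = -g` pointwise and the energy cutoff
`χ = χ_R = χ(H/R)` (`R > 0`):
`∫ g w χ² e^{-H/T} = γT Σ_{b ∈ {0, N-1}} (∫ (∂_{p_b}w)² χ² e^{-H/T} + 2∫ w χ ∂_{p_b}χ ∂_{p_b}w e^{-H/T})`
(test the equation against `w χ² e^{-H/T}`; Liouville part: `integral_liouville_mul_mul_cutoff_sq`; baths: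
`integral_bath_mul_mul_cutoff_sq`). -/
theorem cutoff_identity {w g : PhaseSpace N → ℝ} (hw : ContDiff ℝ 2 w)
    (hLw : ∀ x, (pinnedChain ω₂ lam β γ).generator N T T w x = -g x) {R : ℝ} (hR : 0 < R)
    {χ : PhaseSpace N → ℝ} (hχ : ∀ x, χ x = smoothCutoff ((pinnedChain ω₂ lam β γ).hamiltonian N x / R)) :
    ∫ x, g x * w x * (χ x * χ x) * (pinnedChain ω₂ lam β γ).gibbsDensity N T x =
      γ * T * (((∫ x, (partialP ⟨0, by omega⟩ w x) ^ 2 * (χ x * χ x) *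
            (pinnedChain ω₂ lam β γ).gibbsDensity N T x) +
          2 * ∫ x, w x * χ x * partialP ⟨0, by omega⟩ χ x * partialP ⟨0, by omega⟩ w x *
            (pinnedChain ω₂ lam β γ).gibbsDensity N T x) +
        ((∫ x, (partialP ⟨N - 1, by omega⟩ w x) ^ 2 * (χ x * χ x) *
            (pinnedChain ω₂ lam β γ).gibbsDensity N T x) +
          2 * ∫ x, w x * χ x * partialP ⟨N - 1, by omega⟩ χ x * partialP ⟨N - 1, by omega⟩ w x *
            (pinnedChain ω₂ lam β γ).gibbsDensity N T x)) := by
  set P := pinnedChain ω₂ lam β γ with hP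
  have hU : ContDiff ℝ ∞ P.U := pinnedChain_contDiff_U ω₂ lam β γ
  have hV : ContDiff ℝ ∞ P.V := pinnedChain_contDiff_V ω₂ lam β γ
  have hU1 : ContDiff ℝ 1 P.U := pinnedChain_contDiff_U ω₂ lam β γ
  have hV1 : ContDiff ℝ 1 P.V := pinnedChain_contDiff_V ω₂ lam β γ
  have hγ' : P.γ = γ := rfl
  set ρ := P.gibbsDensity N T with hρ
  have hχf : χ = fun x => smoothCutoff (P.hamiltonian N x / R) := funext hχ
  have hH1 : ContDiff ℝ 1 (P.hamiltonian N) := P.contDiff_hamiltonian hU1 hV1 N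
  have hHd : Differentiable ℝ (P.hamiltonian N) := hH1.differentiable one_ne_zero
  have hχs : ContDiff ℝ ∞ χ := by
    rw [hχf]; exact contDiff_energyCutoff (ω₂ := ω₂) (lam := lam) (β := β) γ N R
  have hχc : HasCompactSupport χ := by rw [hχf]; exact hasCompactSupport_energyCutoff hω hl hβ γ N hR
  have hχ2 : ContDiff ℝ 2 χ := hχs.of_le (by norm_cast)
  have hχ1 : ContDiff ℝ 1 χ := hχs.of_le (by norm_cast)
  have hw1 : ContDiff ℝ 1 w := hw.of_le (by norm_num)
  have hρc : Continuous ρ := P.continuous_gibbsDensity hU.continuous hV.continuous N T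
  have hk1 : ∀ i, ContDiff ℝ 1 (partialP i w) := fun i => contDiff_partialP hw (by norm_num) i
  -- `{H, χ²} = 0` termwise
  have hψ : ∀ u, HasDerivAt (fun v => smoothCutoff (v / R) * smoothCutoff (v / R))
      (smoothCutoff (u / R) * (deriv smoothCutoff (u / R) / R) +
        smoothCutoff (u / R) * (deriv smoothCutoff (u / R) / R)) u := fun u =>
    (hasDerivAt_smoothCutoff_div R u).mul (hasDerivAt_smoothCutoff_div R u) |>.congr_deriv (by ring)
  have hLχ : ∀ x, ∀ i : Fin N, x.2 i * partialQ i (fun y => χ y * χ y) x -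
      partialQ i (P.hamiltonian N) x * partialP i (fun y => χ y * χ y) x = 0 := by
    intro x i
    simp only [hχ]
    exact liouville_comp_hamiltonian_eq_zero P hHd hψ i x
  -- (X) the Liouville terms vanish, (Y) the bath terms are carré du champ
  have hX : ∀ i : Fin N, ∫ x, (x.2 i * partialQ i w x - partialQ i (P.hamiltonian N) x * partialP i w x) *
      (w x * (χ x * χ x)) * ρ x = 0 := fun i =>
    integral_liouville_mul_mul_cutoff_sq P hU1 hV1 N T hw1 hχ1 hχc hLχ i
  have hY : ∀ i : Fin N, ∫ x, (T * partialP i (partialP i w) x - x.2 i * partialP i w x) *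
      (w x * (χ x * χ x)) * ρ x = -T * ((∫ x, (partialP i w x) ^ 2 * (χ x * χ x) * ρ x) +
        2 * ∫ x, w x * χ x * partialP i χ x * partialP i w x * ρ x) := fun i =>
    integral_bath_mul_mul_cutoff_sq P hU1 hV1 N hT.ne' hw hχ2 hχc i
  -- assemble `∫ (Lw) wχ² ρ = Σ_i X_i + γ (Y₀ + Y₁)`
  set b₀ : Fin N := ⟨0, by omega⟩ with hb₀
  set b₁ : Fin N := ⟨N - 1, by omega⟩ with hb₁
  have hFc : HasCompactSupport (fun x => w x * (χ x * χ x)) := (hχc.mul_left (f := χ)).mul_left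
  have hLk : ∀ x, P.generator N T T w x * (w x * (χ x * χ x)) * ρ x =
      (∑ i, (x.2 i * partialQ i w x - partialQ i (P.hamiltonian N) x * partialP i w x) *
        (w x * (χ x * χ x)) * ρ x) +
      P.γ * ((T * partialP b₀ (partialP b₀ w) x - x.2 b₀ * partialP b₀ w x) * (w x * (χ x * χ x)) * ρ x +
        (T * partialP b₁ (partialP b₁ w) x - x.2 b₁ * partialP b₁ w x) * (w x * (χ x * χ x)) * ρ x) := by
    intro x
    rw [OscillatorChain.generator, sum_ite_ends_eq hN]
    simp only [add_mul, Finset.sum_mul]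
    ring
  have hWc : ∀ i, Continuous (partialQ i (P.hamiltonian N)) := fun i => P.continuous_partialQ_hamiltonian hH1 i
  have intA : ∀ i, Integrable (fun x => (x.2 i * partialQ i w x -
      partialQ i (P.hamiltonian N) x * partialP i w x) * (w x * (χ x * χ x)) * ρ x) := by
    intro i
    have hQkc : Continuous (partialQ i w) := continuous_partialQ hw two_ne_zero i
    have hPkc : Continuous (partialP i w) := continuous_partialP hw two_ne_zero i
    have hχcont : Continuous χ := hχs.continuous
    refine Continuous.integrable_of_hasCompactSupport (by fun_prop) ?_
    exact (hFc.mul_left).mul_right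
  have intS : ∀ i, Integrable (fun x => (T * partialP i (partialP i w) x - x.2 i * partialP i w x) *
      (w x * (χ x * χ x)) * ρ x) := by
    intro i
    have hPkc : Continuous (partialP i w) := (hk1 i).continuous
    have hPPkc : Continuous (partialP i (partialP i w)) := continuous_partialP (hk1 i) one_ne_zero i
    have hχcont : Continuous χ := hχs.continuous
    refine Continuous.integrable_of_hasCompactSupport (by fun_prop) ?_
    exact (hFc.mul_left).mul_right
  have hmain : ∫ x, g x * w x * (χ x * χ x) * ρ x = -∫ x, P.generator N T T w x * (w x * (χ x * χ x)) * ρ x := by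
    rw [← integral_neg]
    refine integral_congr_ae (Eventually.of_forall fun x => ?_)
    dsimp only
    rw [hLw x]
    ring
  rw [hmain]
  simp_rw [hLk]
  have intB : Integrable (fun x => P.γ *
      ((T * partialP b₀ (partialP b₀ w) x - x.2 b₀ * partialP b₀ w x) * (w x * (χ x * χ x)) * ρ x +
        (T * partialP b₁ (partialP b₁ w) x - x.2 b₁ * partialP b₁ w x) * (w x * (χ x * χ x)) * ρ x)) :=
    ((intS b₀).add (intS b₁)).const_mul P.γ
  have intAs : Integrable (fun x => ∑ i, (x.2 i * partialQ i w x -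
      partialQ i (P.hamiltonian N) x * partialP i w x) * (w x * (χ x * χ x)) * ρ x) :=
    integrable_finsetSum _ fun i _ => intA i
  rw [integral_add intAs intB, integral_finsetSum _ (fun i _ => intA i), integral_const_mul,
    integral_add (intS b₀) (intS b₁)]
  simp only [hX, Finset.sum_const_zero, zero_add]
  rw [hY b₀, hY b₁, hγ']
  ring

omit hN in
/-- Integrability bookkeeping: for continuous `w, g = O(e^{H/(8T)})`, `g w e^{-H/T} ∈ L¹` and
`p_i² w² e^{-H/T} ∈ L¹` (`e^{H/(4T)} e^{-H/T}, e^{H/(2T)} e^{-H/T} ∈ L¹`, `p_i² ≤ 2H ≤ 8T e^{H/(4T)}`). -/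
theorem integrable_weights {w g : PhaseSpace N → ℝ} (hwc : Continuous w) (hgc : Continuous g) {A Cg : ℝ}
    (hwb : ∀ z, |w z| ≤ A * Real.exp ((pinnedChain ω₂ lam β γ).hamiltonian N z / (8 * T)))
    (hgb : ∀ z, |g z| ≤ Cg * Real.exp ((pinnedChain ω₂ lam β γ).hamiltonian N z / (8 * T))) :
    Integrable (fun x => g x * w x * (pinnedChain ω₂ lam β γ).gibbsDensity N T x) ∧
    ∀ i : Fin N, Integrable (fun x => x.2 i ^ 2 * w x ^ 2 * (pinnedChain ω₂ lam β γ).gibbsDensity N T x) := by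
  set P := pinnedChain ω₂ lam β γ with hP
  set ρ := P.gibbsDensity N T with hρ
  have hρc : Continuous ρ := pinnedChain_continuous_gibbsDensity ω₂ lam β γ N T
  have hρ0 : ∀ x, 0 ≤ ρ x := fun x => (P.gibbsDensity_pos N T x).le
  have h4 : (1 : ℝ) / (4 * T) < 1 / T := by
    rw [div_lt_div_iff_of_pos_left one_pos (by positivity) hT]; linarith
  have h2 : (1 : ℝ) / (2 * T) < 1 / T := by
    rw [div_lt_div_iff_of_pos_left one_pos (by positivity) hT]; linarith
  have hI4 := pinnedChain_integrable_exp_mul_gibbsDensity hω hl hβ γ N hT h4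
  have hI2 := pinnedChain_integrable_exp_mul_gibbsDensity hω hl hβ γ N hT h2
  set H := P.hamiltonian N with hH
  have hexp88 : ∀ z, Real.exp (H z / (8 * T)) * Real.exp (H z / (8 * T)) = Real.exp (1 / (4 * T) * H z) := by
    intro z; rw [← Real.exp_add]; congr 1; ring
  have hexp44 : ∀ z, Real.exp (H z / (4 * T)) * Real.exp (H z / (4 * T)) = Real.exp (1 / (2 * T) * H z) := by
    intro z; rw [← Real.exp_add]; congr 1; ring
  have hexp84 : ∀ z, Real.exp (H z / (8 * T)) * Real.exp (H z / (8 * T)) = Real.exp (H z / (4 * T)) := by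
    intro z; rw [← Real.exp_add]; congr 1; ring
  constructor
  · refine (hI4.const_mul (Cg * A)).mono' (((hgc.mul hwc).mul hρc).aestronglyMeasurable)
      (Eventually.of_forall fun z => ?_)
    rw [Real.norm_eq_abs, abs_mul, abs_of_nonneg (hρ0 z), abs_mul]
    calc |g z| * |w z| * ρ z ≤ (Cg * Real.exp (H z / (8 * T))) * (A * Real.exp (H z / (8 * T))) * ρ z := by
          refine mul_le_mul_of_nonneg_right ?_ (hρ0 z)
          exact mul_le_mul (hgb z) (hwb z) (abs_nonneg _) ((abs_nonneg _).trans (hgb z))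
      _ = Cg * A * (Real.exp (1 / (4 * T) * H z) * ρ z) := by rw [← hexp88]; ring
  · intro i
    refine (hI2.const_mul (8 * T * A ^ 2)).mono' ?_ (Eventually.of_forall fun z => ?_)
    · exact (((((continuous_apply i).comp continuous_snd).pow 2).mul (hwc.pow 2)).mul hρc).aestronglyMeasurable
    · have hH0 : 0 ≤ H z := pinnedChain_hamiltonian_nonneg hω.le hl hβ γ N z
      have hp : z.2 i ^ 2 ≤ 2 * H z := by
        have hsum := pinnedChain_harmonic_le_hamiltonian (ω₂ := ω₂) hl hβ γ N z
        have h1 : 0 ≤ ∑ j, ω₂ * z.1 j ^ 2 / 2 := Finset.sum_nonneg fun j _ => by positivity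
        have h2 : z.2 i ^ 2 / 2 ≤ ∑ j, z.2 j ^ 2 / 2 :=
          Finset.single_le_sum (f := fun j => z.2 j ^ 2 / 2) (fun j _ => by positivity) (Finset.mem_univ _)
        rw [hH]
        linarith
      have h4T : 0 < 4 * T := by positivity
      have hHexp : H z ≤ 4 * T * Real.exp (H z / (4 * T)) := by
        have h1 := Real.add_one_le_exp (H z / (4 * T))
        have h2 : H z / (4 * T) ≤ Real.exp (H z / (4 * T)) := by linarith
        rw [div_le_iff₀ h4T] at h2
        linarith
      have hw2 : w z ^ 2 ≤ A ^ 2 * Real.exp (H z / (4 * T)) := by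
        have h1 := pow_le_pow_left₀ (abs_nonneg _) (hwb z) 2
        rw [sq_abs] at h1
        calc w z ^ 2 ≤ (A * Real.exp (H z / (8 * T))) ^ 2 := h1
          _ = A ^ 2 * (Real.exp (H z / (8 * T)) * Real.exp (H z / (8 * T))) := by ring
          _ = A ^ 2 * Real.exp (H z / (4 * T)) := by rw [hexp84]
      have hE0 : 0 ≤ Real.exp (H z / (4 * T)) := (Real.exp_pos _).le
      have step : z.2 i ^ 2 * w z ^ 2 ≤ (2 * (4 * T * Real.exp (H z / (4 * T)))) *
          (A ^ 2 * Real.exp (H z / (4 * T))) :=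
        mul_le_mul (hp.trans (by linarith)) hw2 (sq_nonneg _) (by positivity)
      rw [Real.norm_eq_abs, abs_of_nonneg (mul_nonneg (mul_nonneg (sq_nonneg _) (sq_nonneg _)) (hρ0 z))]
      calc z.2 i ^ 2 * w z ^ 2 * ρ z ≤ (2 * (4 * T * Real.exp (H z / (4 * T)))) *
            (A ^ 2 * Real.exp (H z / (4 * T))) * ρ z := mul_le_mul_of_nonneg_right step (hρ0 z)
        _ = 8 * T * A ^ 2 * ((Real.exp (H z / (4 * T)) * Real.exp (H z / (4 * T))) * ρ z) := by ring
        _ = 8 * T * A ^ 2 * (Real.exp (1 / (2 * T) * H z) * ρ z) := by rw [hexp44]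

end Pinned

end OrthogonalOhmLine.DirichletBound

/-! ## Registered helper stub -/

open OrthogonalOhmLine.DirichletBound in
/-- **Registered helper stub of this file** (`helper_dirichletBoundCutoffIdentity`, sub-goal of stub
`stub_dirichletBound` of crux stmt-AtomisticToContinuum-12693): the cutoff identity (= `cutoff_identity`). -/
theorem helper_dirichletBoundCutoffIdentity : ∀ (N : ℕ) (ω₂ lam β γ : ℝ), 0 < ω₂ → 0 ≤ lam → 0 ≤ β → ∀ (hN : 2 ≤ N) (T : ℝ), 0 < T → ∀ (w g : Literature.MathematicalPhysics.KineticTheory.HeatConduction.PhaseSpace N → ℝ), ContDiff ℝ 2 w → (∀ x, (Literature.MathematicalPhysics.KineticTheory.HeatConduction.pinnedChain ω₂ lam β γ).generator N T T w x = -g x) → ∀ (R : ℝ), 0 < R → ∀ (χ : Literature.MathematicalPhysics.KineticTheory.HeatConduction.PhaseSpace N → ℝ), (∀ x, χ x = Literature.MathematicalPhysics.KineticTheory.HeatConduction.smoothCutoff ((Literature.MathematicalPhysics.KineticTheory.HeatConduction.pinnedChain ω₂ lam β γ).hamiltonian N x / R)) → ∫ x, g x * w x * (χ x * χ x) * (Literature.MathematicalPhysics.KineticTheory.HeatConduction.pinnedChain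 ω₂ lam β γ).gibbsDensity N T x = γ * T * (((∫ x, (Literature.MathematicalPhysics.KineticTheory.HeatConduction.partialP ⟨0, by omega⟩ w x) ^ 2 * (χ x * χ x) * (Literature.MathematicalPhysics.KineticTheory.HeatConduction.pinnedChain ω₂ lam β γ).gibbsDensity N T x) + 2 * ∫ x, w x * χ x * Literature.MathematicalPhysics.KineticTheory.HeatConduction.partialP ⟨0, by omega⟩ χ x * Literature.MathematicalPhysics.KineticTheory.HeatConduction.partialP ⟨0, by omega⟩ w x * (Literature.MathematicalPhysics.KineticTheory.HeatConduction.pinnedChain ω₂ lam β γ).gibbsDensity N T x) + ((∫ x, (Literature.MathematicalPhysics.KineticTheory.HeatConduction.partialP ⟨N - 1, by omega⟩ w x) ^ 2 * (χ x * χ x) * (Literature.MathematicalPhysics.KineticTheory.HeatConduction.pinnedChain ω₂ lam β γ).gibbsDensity N T x) + 2 * ∫ x, w x * χ x * Literature.MathematicalPhysics.KineticTheory.HeatConduction.partialP ⟨N - 1, by omega⟩ χ x * Literature.MathematicalPhysics.KineticTheory.HeatConduction.partialP ⟨N - 1, by omega⟩ w x * (Literature.MathematicalPhysics.KineticTheory.HeatConduction.pinnedChain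 ω₂ lam β γ).gibbsDensity N T x)) :=
  fun _ _ _ _ _ hω hl hβ hN _ hT _ _ hw hLw _ hR _ hχ => cutoff_identity hω hl hβ hN hT hw hLw hR hχ

end Summit.AtomisticToContinuum.FouriersLaw.Theorems.HonestZwanzig

end
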